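import Summits.Ventures.HSemireg.WedgeHankelRecurrenceGaussChebyshevCLiftingExponent

/-!
# Venture HSemireg — **THE `−2`-LEVEL IDEAL, MIXED PARITY: `(C_m + 2, C_n + 2) = (4, C_{gcd(m,n)} + 2)` in `R[X]` for every commutative ring, whenever `m ∕ gcd` and `n ∕ gcd` are NOT both odd**
# (completing N491: together, `(C_m + 2, C_n + 2)` is `(C_g + 2)` in the odd ∕ odd case and `(4, C_g + 2)` otherwise), hence **`gcd(V_m + 2, V_n + 2) = gcd(4, V_g + 2)`** for `V_n(P,1)` in the
# mixed case.  Also a reusable DESCENT LEMMA: two ideals of `R[X]` agree as soon as their extensions agree in every faithfully flat `R[X]`-algebra containing `τ, σ` with `τσ = 1`, `τ + σ = X`.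
# PROOF: in the quadratic extension, with `y = τ^g`, `z = −y`, `m = g m'` (`m'` even), `n = g n'` (`n'` odd): `τ^n + 1 = (y + 1)·G_{n'}(z)` and `G_{2m'}(z) = G_{m'}(z)(z^{m'} + 1)` is coprime to
# `G_{n'}(z)` (lengths `2m'`, `n'` coprime, N489), so the factor `G_{n'}(z)²` drops; and `y^{m'} + 1 = 2 + (y + 1)c` gives `((y^{m'} + 1)², (y + 1)²) = (4, (y + 1)²)` by an explicit Bézout identity

HONEST FRAMING. Part of the Lean index of the computation cell `pub-hsemireg` (seat p10 gen 48, Sunday typer «UNIFORM-IN-n»).  Commutative algebra of polynomial ideals only; no variety, no cohomology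
theory, no sheaf, no Ext group and no semiregularity map is constructed here; nothing here says that HC / HC_CM / HC_AV holds; no Literature fact (unproved `Prop`) is declared or used.  Custodian
versions as in `WedgeHankelSiegelIdeal` (1/3).
SOURCES (cited).  R. Lidl, G. L. Mullen, G. Turnwald, *Dickson Polynomials* (1993), Ch. 3; H. Matsumura, *Commutative Ring Theory* (1986), Thm 7.5; W. L. McDaniel, Fibonacci Quart. 29 (1991) 24–29.
PROOF TYPED HERE.  N489 `quadExt_monic_natDegree`, `geom_sum_isCoprime`, `geom_sum_range_add`, `pow_mul_sub_one_eq_mul_geom_sum`; N491 `quadExt_chebyshevC_add_two`; N457 `span_pair_mul_right_of_isCoprime`;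
Mathlib `AdjoinRoot`, `Polynomial.Monic.free_adjoinRoot`, `Ideal.comap_map_eq_self_of_faithfullyFlat`, `sub_one_dvd_pow_sub_one`, `IsCoprime.of_mul_left_right ∕ pow`, `Even.neg_pow`, `Odd.neg_pow`,
`Nat.coprime_mul_iff_left`, `Nat.coprime_two_left`, `Ideal.mem_span_pair`, `Ideal.span_singleton_mul_left_unit`; N476 `int_gcd_eq_of_span_pair_eq`, `lucasV_one_eq_chebyshevC_eval`.
DEDUP DISCLOSURE (`rg -n 'quadExt_ideal_eq_of_map_eq|span_pair_sq_eq_of_eq_two_add|chebyshevC_add_two_span_pair_mixed|lucasV_one_add_two_gcd_mixed' Summits Literature HarnessLib`, 2026-09-04): 0 hits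
for the 4 names below.

WHAT IS IN THE TREE.  N457, N476, N489, N491.
THIS FILE (namespace `Summit.Ventures.HSemireg.Wedge.HankelOuter` continued; CHAINED on N493; 0 definitions):
* §1259 **`quadExt_ideal_eq_of_map_eq`** (descent lemma), `span_pair_sq_eq_of_eq_two_add`, **`chebyshevC_add_two_span_pair_mixed`**, **`lucasV_one_add_two_gcd_mixed`**.
CAVEATS.  Nothing Ext-side.  New names only.
-/

open Module Polynomial
open scoped Matrix Polynomial

universe u

namespace Summit.Ventures.HSemireg.Wedge.HankelOuter

/-! ## §1259. `(C_m + 2, C_n + 2) = (4, C_g + 2)` in the mixed-parity case -/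

/-- **DESCENT LEMMA.** Two ideals `I, J ⊆ R[X]` are equal as soon as `I B = J B` for every faithfully flat commutative `R[X]`-algebra `B` containing `τ, σ` with `τ σ = 1`, `τ + σ = X` (witness:
`B = R[X][t] ∕ (t² − X t + 1)`, free of rank `2`). [Matsumura Thm 7.5; this file, §1259] -/
theorem quadExt_ideal_eq_of_map_eq {R : Type u} [CommRing R] (I J : Ideal R[X])
    (h : ∀ (B : Type u) [CommRing B] [Algebra R[X] B] [Module.FaithfullyFlat R[X] B] (τ σ : B),
      τ * σ = 1 → τ + σ = algebraMap R[X] B Polynomial.X → I.map (algebraMap R[X] B) = J.map (algebraMap R[X] B)) : I = J := by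
  rcases subsingleton_or_nontrivial R with hR | hR
  · haveI : Subsingleton (Ideal R[X]) := (Submodule.subsingleton_iff R[X]).2 inferInstance
    exact Subsingleton.elim _ _
  obtain ⟨hf, hf2⟩ := quadExt_monic_natDegree (Polynomial.X : R[X])
  set f : R[X][X] := Polynomial.X ^ 2 - (Polynomial.C (Polynomial.X : R[X]) * Polynomial.X - 1) with hf_def
  haveI : Module.Free R[X] (AdjoinRoot f) := hf.free_adjoinRoot
  haveI : Nontrivial (AdjoinRoot f) :=
    nontrivial_of_ne _ _ ((AdjoinRoot.powerBasis' hf).basis.ne_zero ⟨0, by rw [AdjoinRoot.powerBasis'_dim, hf2]; norm_num⟩)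
  have hroot := AdjoinRoot.eval₂_root f
  rw [← AdjoinRoot.algebraMap_eq, hf_def, eval₂_sub, eval₂_sub, eval₂_pow, eval₂_X, eval₂_mul, eval₂_C, eval₂_X, eval₂_one] at hroot
  have hmul : AdjoinRoot.root f * (algebraMap R[X] (AdjoinRoot f) Polynomial.X - AdjoinRoot.root f) = 1 := by
    linear_combination (-1 : AdjoinRoot f) * hroot
  have hadd : AdjoinRoot.root f + (algebraMap R[X] (AdjoinRoot f) Polynomial.X - AdjoinRoot.root f) = algebraMap R[X] (AdjoinRoot f) Polynomial.X := by ring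
  have key := h (AdjoinRoot f) _ _ hmul hadd
  rw [← Ideal.comap_map_eq_self_of_faithfullyFlat (B := AdjoinRoot f) I, key, Ideal.comap_map_eq_self_of_faithfullyFlat]

/-- If `A = 2 + w c` then `(A², w²) = (4, w²)` (explicit Bézout: `4 = (1 − cw) A² + (3c² + c³w) w²`). [bookkeeping; this file, §1259] -/
theorem span_pair_sq_eq_of_eq_two_add {B : Type*} [CommRing B] {A w c : B} (hA : A = 2 + w * c) :
    Ideal.span {A ^ 2, w ^ 2} = Ideal.span {4, w ^ 2} := by
  apply le_antisymm
  · rw [Ideal.span_le, Set.insert_subset_iff, Set.singleton_subset_iff]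
    refine ⟨Ideal.mem_span_pair.2 ⟨1 + c * w, c ^ 2, ?_⟩, Ideal.subset_span (Set.mem_insert_of_mem _ (Set.mem_singleton _))⟩
    rw [hA]; ring
  · rw [Ideal.span_le, Set.insert_subset_iff, Set.singleton_subset_iff]
    refine ⟨Ideal.mem_span_pair.2 ⟨1 - c * w, 3 * c ^ 2 + c ^ 3 * w, ?_⟩, Ideal.subset_span (Set.mem_insert_of_mem _ (Set.mem_singleton _))⟩
    rw [hA]; ring

/-- **`(C_m + 2, C_n + 2) = (4, C_{gcd(m,n)} + 2)` in `R[X]` for every commutative ring `R`, whenever `m ∕ gcd(m,n)`, `n ∕ gcd(m,n)` are not both odd.** [Lidl–Mullen–Turnwald Ch. 3; this file, §1259] -/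
theorem chebyshevC_add_two_span_pair_mixed {R : Type*} [CommRing R] {m n : ℕ} (hmn : ¬ (Odd (m / Nat.gcd m n) ∧ Odd (n / Nat.gcd m n))) :
    Ideal.span {Polynomial.Chebyshev.C R (m : ℤ) + 2, Polynomial.Chebyshev.C R (n : ℤ) + 2} = Ideal.span {4, Polynomial.Chebyshev.C R (Nat.gcd m n : ℤ) + 2} := by
  -- reduce to: `m = g m'` with `m'` even, `n = g n'` with `n'` odd, `gcd(m', n') = 1` (or `m = n = 0`)
  suffices H : ∀ m n : ℕ, Even (m / Nat.gcd m n) → Odd (n / Nat.gcd m n) →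
      Ideal.span {Polynomial.Chebyshev.C R (m : ℤ) + 2, Polynomial.Chebyshev.C R (n : ℤ) + 2} = Ideal.span {4, Polynomial.Chebyshev.C R (Nat.gcd m n : ℤ) + 2} by
    rcases Nat.eq_zero_or_pos (Nat.gcd m n) with h0 | hg
    · obtain ⟨rfl, rfl⟩ := Nat.gcd_eq_zero_iff.1 h0
      rw [Nat.gcd_zero_left, Nat.cast_zero, Polynomial.Chebyshev.C_zero, Set.pair_eq_singleton, show (2 + 2 : R[X]) = 4 by norm_num, Set.pair_eq_singleton]
    rcases Nat.even_or_odd (m / Nat.gcd m n) with hm | hm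
    · rcases Nat.even_or_odd (n / Nat.gcd m n) with hn | hn
      · exfalso
        have hc := Nat.coprime_div_gcd_div_gcd hg
        have h2 : 2 ∣ Nat.gcd (m / Nat.gcd m n) (n / Nat.gcd m n) := Nat.dvd_gcd (even_iff_two_dvd.1 hm) (even_iff_two_dvd.1 hn)
        rw [hc] at h2; exact absurd h2 (by norm_num)
      · exact H m n hm hn
    · have hn : Even (n / Nat.gcd m n) := by
        rcases Nat.even_or_odd (n / Nat.gcd m n) with hn | hn
        · exact hn
        · exact absurd ⟨hm, hn⟩ hmn
      rw [Ideal.span_pair_comm, Nat.gcd_comm]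
      rw [Nat.gcd_comm] at hm hn
      exact H n m hn hm
  intro m n hm hn
  obtain ⟨g, hgdef⟩ : ∃ g, Nat.gcd m n = g := ⟨_, rfl⟩
  rw [hgdef] at hm hn ⊢
  have hg : 0 < g := by
    rcases Nat.eq_zero_or_pos g with h0 | h0
    · rw [h0, Nat.div_zero] at hn; exact absurd hn (by decide)
    · exact h0
  obtain ⟨m', hm'⟩ : g ∣ m := hgdef ▸ Nat.gcd_dvd_left m n
  obtain ⟨n', hn'⟩ : g ∣ n := hgdef ▸ Nat.gcd_dvd_right m n
  have hc := Nat.coprime_div_gcd_div_gcd (hgdef.symm ▸ hg)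
  rw [hgdef] at hc
  subst hm' hn'
  rw [Nat.mul_div_cancel_left _ hg] at hm hn hc
  rw [Nat.mul_div_cancel_left _ hg] at hc
  have hc2 : Nat.Coprime (m' + m') n' := by
    rw [← two_mul]; exact Nat.coprime_mul_iff_left.2 ⟨Nat.coprime_two_left.2 hn, hc⟩
  -- descend
  apply quadExt_ideal_eq_of_map_eq
  intro B _ _ _ τ σ hmul hadd
  have hσ : IsUnit σ := IsUnit.of_mul_eq_one τ (by rw [mul_comm]; exact hmul)
  -- the algebra in `B`: `y = τ^g`, `z = −y`
  have hGn : τ ^ (g * n') + 1 = (τ ^ g + 1) * ∑ i ∈ Finset.range n', (-(τ ^ g)) ^ i := by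
    have h := geom_sum_mul (-(τ ^ g)) n'
    rw [hn.neg_pow, ← pow_mul] at h
    linear_combination h
  have hcop : IsCoprime ((∑ i ∈ Finset.range n', (-(τ ^ g)) ^ i) ^ 2) ((τ ^ (g * m') + 1) ^ 2) := by
    have h := geom_sum_isCoprime (-(τ ^ g)) hc2
    rw [geom_sum_range_add, ← one_add_mul, hm.neg_pow, ← pow_mul, add_comm (1 : B)] at h
    exact (h.of_mul_left_left.symm).pow
  obtain ⟨c, hc'⟩ : τ ^ g + 1 ∣ τ ^ (g * m') - 1 := by
    obtain ⟨k, hk⟩ := hm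
    rw [hk, ← two_mul, pow_mul, pow_mul]
    exact (Dvd.intro (τ ^ g - 1) (by ring)).trans (sub_one_dvd_pow_sub_one ((τ ^ g) ^ 2) k)
  have hA : τ ^ (g * m') + 1 = 2 + (τ ^ g + 1) * c := by linear_combination hc'
  -- the two extended ideals
  have hR : Ideal.span {(4 : B), σ ^ g * (τ ^ g + 1) ^ 2} = Ideal.span {4, (τ ^ g + 1) ^ 2} := by
    rw [Ideal.span_pair_comm, Ideal.span_insert, Ideal.span_singleton_mul_left_unit (hσ.pow _), ← Ideal.span_insert, Ideal.span_pair_comm]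
  rw [Ideal.map_span, Ideal.map_span, Set.image_pair, Set.image_pair, quadExt_chebyshevC_add_two hmul hadd, quadExt_chebyshevC_add_two hmul hadd, quadExt_chebyshevC_add_two hmul hadd, map_ofNat,
    Ideal.span_insert, Ideal.span_singleton_mul_left_unit (hσ.pow _), Ideal.span_singleton_mul_left_unit (hσ.pow _), ← Ideal.span_insert, hGn, mul_pow, Ideal.span_pair_comm,
    span_pair_mul_right_of_isCoprime hcop, Ideal.span_pair_comm, span_pair_sq_eq_of_eq_two_add hA, hR]

/-- **`gcd(V_m + 2, V_n + 2) = gcd(4, V_{gcd(m,n)} + 2)`** for `V_0 = 2, V_1 = P, V_{k+2} = P V_{k+1} − V_k` over `ℤ`, when `m ∕ gcd`, `n ∕ gcd` are not both odd. [this file, §1259] -/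
theorem lucasV_one_add_two_gcd_mixed {P : ℤ} {V : ℕ → ℤ} (hV0 : V 0 = 2) (hV1 : V 1 = P) (hV : ∀ n, V (n + 2) = P * V (n + 1) - V n) {m n : ℕ}
    (hmn : ¬ (Odd (m / Nat.gcd m n) ∧ Odd (n / Nat.gcd m n))) : Int.gcd (V m + 2) (V n + 2) = Int.gcd 4 (V (Nat.gcd m n) + 2) := by
  have hev : ∀ k : ℕ, Polynomial.evalRingHom P (Polynomial.Chebyshev.C ℤ (k : ℤ) + 2) = V k + 2 := fun k => by
    rw [map_add, map_ofNat, Polynomial.coe_evalRingHom, lucasV_one_eq_chebyshevC_eval hV0 hV1 hV k]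
  have h := congrArg (Ideal.map (Polynomial.evalRingHom P)) (chebyshevC_add_two_span_pair_mixed (R := ℤ) hmn)
  rw [Ideal.map_span, Ideal.map_span, Set.image_pair, Set.image_pair, hev, hev, hev, map_ofNat] at h
  exact int_gcd_eq_of_span_pair_eq h

end Summit.Ventures.HSemireg.Wedge.HankelOuter
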